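import Literature.Topology.FourManifolds.SchoenfliesIsotopyChart
import Literature.Topology.FourManifolds.ConnectedSumNormalForm
import Literature.Topology.FourManifolds.SphereMapsMissPoints
import Literature.Topology.FourManifolds.RadialStretch
import HarnessLib

/-!
# The Schoenflies theorem in `S³`: isotopy form from ball form

Topic `Literature/Topology/FourManifolds` (trunk T-4MAN). Second file (after
`SchoenfliesIsotopyChart.lean`) of the proof of the isotopy form of the Schoenflies theorem in
`S³` from its ball form, a step of the decomposition of the named fact
`Literature.Topology.FourManifolds.Knot.IsConnectedSum.isIsotopic` (`BandSum.lean`; H. Schubert 1949: the connected sum of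
oriented knots is well defined). Proved here:

* `Literature.Topology.FourManifolds.SphereEmbedding.schoenflies_exists_ambientIsotopy_image_eq_sphereEquator_of_ball` —
  `schoenflies_exists_ball → schoenflies_exists_ambientIsotopy_image_eq_sphereEquator`
  (both named facts of `SchoenfliesSphereThree.lean`): granted Alexander's theorem in ball
  form (Schultens (2014), Thm. 3.2.5), every smoothly embedded 2-sphere `S ⊆ 𝕊 3` is carried
  onto the equator `{x₃ = 0}` by an ambient isotopy — the disc theorem (Hirsch (1976), Ch. 8
  §3, Thm. 3.1 with §1, Thm. 1.3) applied to the image of the bounding ball;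
* `Literature.Topology.FourManifolds.Knot.IsConnectedSum.isIsotopic_of_ball_of_normalPosition` — consequently the target
  fact `Knot.IsConnectedSum.isIsotopic` follows from `schoenflies_exists_ball` and
  `Knot.Schubert1949_normalPosition` alone (via `IsConnectedSum.isIsotopic_of_normalPosition`,
  `ConnectedSumNormalForm.lean`), i.e. the Schoenflies input of Schubert's theorem is reduced to
  Alexander's theorem proper;
* the ingredients: `KnotsInBall.stereographic'_northPole_symm_image_sphere_two` (in the
  stereographic chart from the north pole the equator is the round sphere of radius `2`),
  `exists_scaledStretch` (a radial diffeomorphism `ℝ³ → B(0, r)` fixing `0` and mapping a round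
  sphere onto the unit sphere, from `RadialStretch.lean`), `exists_chart_comp_embedding` (the
  smooth chart of `ℝ³` inverse to `σ_c ∘ e ∘ K` for an embedded ball `e` missing the pole of the
  stereographic chart `σ`).

*Proof of the main theorem.* Take `p ∉ S` (`SphereEmbedding.exists_notMem_range`) and a
diffeomorphism `P₀` diffeotopic to the identity with `P₀ p = n`, the north pole
(`Diffeomorph.exists_isDiffeotopicToId_apply_eq_euclidean`, `Homogeneity.lean`). The ball form
for `P₀ ∘ S` and `n` gives a smooth embedding `e : ℝ³ → 𝕊 3` with `e (S²) = P₀ (range S)` and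
`n ∉ e (D³)`, hence `n ∉ e (B(0, r))` for some `r > 1` (injectivity). In the chart
`σ_c = σ - σ (e 0)` from `n`, the map `f = σ_c ∘ e ∘ K` is the inverse of a smooth chart of
`ℝ³` fixing `0` with invertible derivative there, and `e (S²) = σ_c⁻¹ (f (S(0, a)))`; the chart
form of the disc argument (`exists_ambientIsotopy_image_sphere_of_chart'`) gives a compactly
supported ambient isotopy `H` of `ℝ³` with `H₁ (f (S(0, a))) = S(-c, 2)`; transported along
`σ_c` (`AmbientIsotopy.alongChart`) its end stage `D` is diffeotopic to the identity and carries
`e (S²)` onto `σ⁻¹ (S(0, 2)) = {x₃ = 0}`; so `D ∘ P₀` is diffeotopic to the identity, hence the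
end stage of an ambient isotopy (`Diffeomorph.IsDiffeotopicToId.isAmbientIsotopic`), and
carries `range S` onto the equator.

## References

* M. W. Hirsch, *Differential Topology*, GTM 33 (1976), Ch. 8 §1, Thm. 1.3 (PDF p. 167 of the
  held copy); Ch. 8 §3, Thm. 3.1 (PDF p. 172). [HirschDT1976]
* J. Schultens, *Introduction to 3-Manifolds*, GSM 151 (2014), Thm. 3.2.5 (PDF p. 43 of the held
  copy) and §4.1 (PDF p. 71: "for 2-dimensional knots in `S³` there is only one possibility,
  namely the standard 2-sphere"). [Schultens2014]
* P. R. Cromwell, *Knots and Links* (2004), §4.6 (PDF p. 69 of the held copy). [Cromwell2004]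
* H. Schubert, *Die eindeutige Zerlegbarkeit eines Knotens in Primknoten*, S.-B. Heidelberger
  Akad. Wiss. Math.-Nat. Kl. 1949, no. 3, 57–104. [Schubert1949]

## Design notes

* Relation to `SchoenfliesBallForm.lean` (landed the same day): that file proves, in every
  dimension, *ball form ↔ equator form up to a diffeomorphism of the sphere* by Palais' disc
  theorem in its static form (`exists_diffeomorph_apply_stereographic_symm_eq`). The present
  file needs and proves more in dimension `3`: the equator is reached by an *ambient isotopy*
  (a diffeomorphism diffeotopic to the identity), which is what `Knot.IsConnectedSum.isIsotopic`
  consumes; this uses the connectedness of `GL⁺(3)` (`AffineAmbientIsotopy.lean`) and the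
  isotopy-extension machinery instead of the static disc theorem.
* After this file the trust base of `Knot.IsConnectedSum.isIsotopic` along this decomposition is
  `{SphereEmbedding.schoenflies_exists_ball, Knot.Schubert1949_normalPosition}`.
* Notation `𝔼 n`, `𝕊 n` is local, as in `Knots.lean`; `attribute [local instance]
  fact_finrank_euclideanSpace_succ` as in `ConnectedSumNormalForm.lean` (for the stereographic
  norm lemmas of `KnotsInBall.lean`). The file declares theorems only.
-/

open scoped Manifold ContDiff Topology
open Function Set Metric

noncomputable section

namespace Literature.Topology.FourManifolds

/-- Local notation: `𝔼 n` is the model Euclidean space `EuclideanSpace ℝ (Fin n)`. -/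
local notation "𝔼 " n:arg => EuclideanSpace ℝ (Fin n)

/-- Local notation: `𝕊 n` is the unit sphere in `EuclideanSpace ℝ (Fin (n + 1))`. -/
local notation "𝕊 " n:arg => (Metric.sphere (0 : EuclideanSpace ℝ (Fin (n + 1))) 1)

attribute [local instance] fact_finrank_euclideanSpace_succ

namespace KnotsInBall

/-! ### The equator in the stereographic chart from the north pole -/

/-- In the stereographic chart of `𝕊 3` from the north pole, the equator `{x₃ = 0}` is the round
sphere of radius `2` (`‖σ x‖ = 2 ↔ x₃ = 0`, from `norm_stereographic'_le_two_iff` and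
`norm_stereographic'_lt_two_iff`). [folklore] -/
theorem stereographic'_northPole_symm_image_sphere_two :
    (stereographic' 3 (northPole : 𝕊 3)).symm '' sphere (0 : 𝔼 3) 2 = sphereEquator 2 := by
  set σ := stereographic' 3 (northPole : 𝕊 3) with hσ
  have htgt : ∀ w : 𝔼 3, w ∈ σ.target := fun w ↦ by
    rw [hσ, stereographic'_target]; trivial
  have hsrc : ∀ x : 𝕊 3, x ≠ northPole → x ∈ σ.source := fun x hx ↦ by
    rw [hσ, stereographic'_source]; exact hx
  -- `‖σ x‖ = 2 ↔ x₃ = 0` for `x ≠ northPole`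
  have key : ∀ x : 𝕊 3, x ≠ northPole → (‖σ x‖ = 2 ↔ (x : 𝔼 4) (Fin.last 3) = 0) := by
    intro x hx
    have h1 := norm_stereographic'_le_two_iff (n := 3) northPole x hx
    have h2 := norm_stereographic'_lt_two_iff (n := 3) northPole x hx
    rw [inner_northPole] at h1 h2
    constructor
    · intro h
      have hle : (x : 𝔼 4) (Fin.last 3) ≤ 0 := h1.1 h.le
      have hge : ¬ (x : 𝔼 4) (Fin.last 3) < 0 := fun hlt ↦ by
        have := h2.2 hlt; rw [h] at this; exact lt_irrefl _ this
      exact le_antisymm hle (not_lt.1 hge)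
    · intro h
      have hle : ‖σ x‖ ≤ 2 := h1.2 h.le
      have hge : ¬ ‖σ x‖ < 2 := fun hlt ↦ by
        have := h2.1 hlt; rw [h] at this; exact lt_irrefl _ this
      exact le_antisymm hle (not_lt.1 hge)
  ext x
  constructor
  · rintro ⟨w, hw, rfl⟩
    have hne : σ.symm w ≠ northPole := by
      have : σ.symm w ∈ σ.source := σ.map_target (htgt w)
      rw [hσ, stereographic'_source] at this
      exact this
    rw [mem_sphereEquator_iff, ← key _ hne, σ.right_inv (htgt w)]
    exact mem_sphere_zero_iff_norm.1 hw
  · intro hx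
    have hx0 := (mem_sphereEquator_iff x).1 hx
    have hne : x ≠ northPole := by
      rintro rfl; rw [northPole_apply_last] at hx0; exact one_ne_zero hx0
    exact ⟨σ x, mem_sphere_zero_iff_norm.2 ((key x hne).2 hx0), σ.left_inv (hsrc x hne)⟩

end KnotsInBall

/-! ### A scaled radial stretch `ℝ³ ≅ B(0, r)` -/

/-- **A scaled radial stretch.** For `1 < r` there is a diffeomorphism `K` of `ℝ³` onto an
open subset of the ball `B(0, r)` (packaged as a partial homeomorphism with source `ℝ³`, smooth
with smooth inverse), fixing `0`, which maps some round sphere `S(0, a)`, `a > 0`, onto the unit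
sphere: `K = (r / 3) · stretch` for the radial stretch `ℝ³ ≅ B(0, 3)` of `RadialStretch.lean`.
[folklore] -/
theorem exists_scaledStretch {r : ℝ} (hr1 : 1 < r) :
    ∃ (K : OpenPartialHomeomorph (𝔼 3) (𝔼 3)) (a : ℝ), K.source = univ ∧ 0 < a ∧ K 0 = 0 ∧
      (∀ z, ‖K z‖ < r) ∧ K '' sphere 0 a = sphere 0 1 ∧ ContDiff ℝ ∞ K ∧
      ContDiffOn ℝ ∞ K.symm K.target := by
  have hr0 : 0 < r := by linarith
  have hs : (r / 3 : ℝ) ≠ 0 := by positivity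
  set K := (stretchPartialHomeomorph : OpenPartialHomeomorph (𝔼 3) (𝔼 3)).transHomeomorph
    (Homeomorph.smulOfNeZero (r / 3) hs) with hK_def
  have hK : ∀ z, K z = (r / 3) • stretch z := fun z ↦ rfl
  have hKsymm : ∀ w, K.symm w = stretchInv ((r / 3)⁻¹ • w) := fun w ↦ by
    rw [hK_def, OpenPartialHomeomorph.transHomeomorph_symm_apply, comp_apply,
      Homeomorph.smulOfNeZero_symm_apply, stretchPartialHomeomorph_symm_coe]
  have h3r : 3 / r < 3 := by
    rw [div_lt_iff₀ hr0]; nlinarith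
  obtain ⟨a, ha0, ha⟩ := exists_stretchProfile_eq (s := 3 / r) (by positivity) h3r
  have hapos : 0 < a := by
    rcases ha0.lt_or_eq with h | h
    · exact h
    · exfalso
      rw [← h, stretchProfile_zero] at ha
      have : (0 : ℝ) < 3 / r := by positivity
      linarith
  refine ⟨K, a, rfl, hapos, by rw [hK, stretch_zero, smul_zero], fun z ↦ ?_, ?_, ?_, ?_⟩
  · rw [hK, norm_smul, Real.norm_of_nonneg (by positivity)]
    calc r / 3 * ‖stretch z‖ < r / 3 * 3 := by gcongr; exact norm_stretch_lt z
      _ = r := by ring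
  · ext w
    simp only [mem_image, mem_sphere_zero_iff_norm]
    constructor
    · rintro ⟨z, hz, rfl⟩
      rw [hK, norm_smul, Real.norm_of_nonneg (by positivity), norm_stretch, hz, ha]
      field_simp
    · intro hw
      have hw3 : ‖(3 / r) • w‖ < 3 := by
        rw [norm_smul, Real.norm_of_nonneg (by positivity), hw, mul_one]; exact h3r
      refine ⟨stretchInv ((3 / r) • w), ?_, ?_⟩
      · apply injective_stretchProfile
        rw [ha, ← norm_stretch, stretch_stretchInv hw3, norm_smul,
          Real.norm_of_nonneg (by positivity), hw, mul_one]
      · rw [hK, stretch_stretchInv hw3, smul_smul]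
        rw [show r / 3 * (3 / r) = 1 by field_simp, one_smul]
  · have : (K : 𝔼 3 → 𝔼 3) = fun z ↦ (r / 3) • stretch z := funext hK
    rw [this]
    exact contDiff_stretch.const_smul (r / 3)
  · intro w hw
    have hw' : (r / 3)⁻¹ • w ∈ ball (0 : 𝔼 3) 3 := by
      have : w ∈ (Homeomorph.smulOfNeZero (r / 3) hs).symm ⁻¹'
          (stretchPartialHomeomorph : OpenPartialHomeomorph (𝔼 3) (𝔼 3)).target := hw
      rwa [stretchPartialHomeomorph_target, mem_preimage, Homeomorph.smulOfNeZero_symm_apply] at this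
    have h1 : ContDiffWithinAt ℝ ∞ (fun w : 𝔼 3 ↦ stretchInv ((r / 3)⁻¹ • w)) K.target w :=
      ((contDiffAt_stretchInv (mem_ball_zero_iff.1 hw')).comp w
        (contDiff_const_smul _).contDiffAt).contDiffWithinAt
    exact h1.congr (fun y _ ↦ hKsymm y) (hKsymm w)

/-! ### The chart `σ_c ∘ e ∘ K` of `ℝ³` attached to an embedded ball of `𝕊 3` -/

/-- Translates of spheres: `(· + c) '' S(-c, r) = S(0, r)`. [folklore] -/
theorem image_add_right_sphere_neg {E : Type*} [NormedAddCommGroup E] (c : E) (r : ℝ) :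
    (fun u : E ↦ u + c) '' sphere (-c) r = sphere 0 r := by
  ext w
  simp only [mem_image, mem_sphere, dist_eq_norm, sub_neg_eq_add, sub_zero]
  exact ⟨fun ⟨u, hu, huw⟩ ↦ by rw [← huw, hu], fun hw ↦ ⟨w - c, by rw [sub_add_cancel, hw],
    sub_add_cancel w c⟩⟩

/-- **The Euclidean chart attached to an embedded ball.** Let `e : ℝ³ → 𝕊 3` be a smooth
embedding and `v` a point of `𝕊 3` not of the form `e z`, `‖z‖ < r`, for some `r > 1`. With
the scaled stretch `K : ℝ³ → B(0, r)` (`exists_scaledStretch`) and the stereographic chart `σ`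
from `v`, translated so that `e 0` has coordinate `0`, the composite `f = σ_c ∘ e ∘ K` is a
smooth embedding of `ℝ³` onto an open subset of `ℝ³`, i.e. the inverse of a smooth chart `Φ`
of `ℝ³` with full target; `f 0 = 0`, `f` has an invertible derivative at `0`, and the embedded
unit sphere `e (S(0, 1))` is `σ_c⁻¹ (f (S(0, a)))` for the radius `a` with `K (S(0, a)) =
S(0, 1)`. (Packaging of the tree's `exists_chart_of_isSmoothEmbedding`, `ChartTransport.lean`,
with the stretch and the stereographic chart.) [folklore] -/
theorem exists_chart_comp_embedding {e : 𝔼 3 → 𝕊 3}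
    (he : Manifold.IsSmoothEmbedding 𝓘(ℝ, 𝔼 3) (𝓡 3) ∞ e) {v : 𝕊 3} {r : ℝ} (hr1 : 1 < r)
    (hv : ∀ z, ‖z‖ < r → e z ≠ v) :
    ∃ (Φ : OpenPartialHomeomorph (𝔼 3) (𝔼 3)) (a : ℝ) (c : 𝔼 3),
      Φ.target = univ ∧ ContMDiffOn 𝓘(ℝ, 𝔼 3) 𝓘(ℝ, 𝔼 3) ∞ Φ Φ.source ∧
      ContMDiff 𝓘(ℝ, 𝔼 3) 𝓘(ℝ, 𝔼 3) ∞ Φ.symm ∧ Φ.symm 0 = 0 ∧ 0 < a ∧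
      (∃ L : 𝔼 3 ≃L[ℝ] 𝔼 3, HasFDerivAt Φ.symm (L : 𝔼 3 →L[ℝ] 𝔼 3) 0) ∧
      e '' sphere 0 1 =
        (fun w ↦ (stereographic' 3 v).symm (w + c)) '' (Φ.symm '' sphere 0 a) := by
  obtain ⟨K, a, hKs, ha, hK0, hKr, hKa, hKsm, hKsm'⟩ := exists_scaledStretch hr1
  obtain ⟨Φe, hΦet, hΦesymm, hΦes, hΦesm⟩ := exists_chart_of_isSmoothEmbedding he
  set σ := stereographic' 3 v with hσ
  set c : 𝔼 3 := σ (e 0) with hc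
  set σc := σ.transHomeomorph (Homeomorph.addRight (-c)) with hσc
  have hσcs : σc.source = {v}ᶜ := by
    rw [hσc, OpenPartialHomeomorph.transHomeomorph_source, hσ, stereographic'_source]
  have hσc_apply : ∀ x, σc x = σ x + -c := fun x ↦ rfl
  have hσc_symm : ∀ w, σc.symm w = σ.symm (w + c) := fun w ↦ by
    rw [hσc, OpenPartialHomeomorph.transHomeomorph_symm_apply, comp_apply,
      Homeomorph.addRight_symm, neg_neg, Homeomorph.coe_addRight]
  have hveK : ∀ z, e (K z) ≠ v := fun z ↦ hv _ (hKr z)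
  set Φ := (σc.symm.trans Φe).trans K.symm with hΦ_def
  -- the inverse of `Φ` is `σ_c ∘ e ∘ K`
  have hΦsymm : ∀ z, Φ.symm z = σc (e (K z)) := fun z ↦ by
    rw [hΦ_def, OpenPartialHomeomorph.trans_symm_eq_symm_trans_symm,
      OpenPartialHomeomorph.trans_symm_eq_symm_trans_symm, OpenPartialHomeomorph.symm_symm,
      OpenPartialHomeomorph.symm_symm, OpenPartialHomeomorph.coe_trans,
      OpenPartialHomeomorph.coe_trans, comp_apply, comp_apply, hΦesymm]
  have hΦcoe : ∀ x, Φ x = K.symm (Φe (σc.symm x)) := fun x ↦ rfl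
  -- full target
  have hΦt : Φ.target = univ := by
    rw [eq_univ_iff_forall]
    intro z
    rw [hΦ_def, OpenPartialHomeomorph.trans_target, OpenPartialHomeomorph.trans_target]
    refine ⟨by rw [OpenPartialHomeomorph.symm_target, hKs]; trivial, ?_⟩
    rw [mem_preimage, OpenPartialHomeomorph.symm_symm]
    refine ⟨by rw [hΦet]; trivial, ?_⟩
    rw [mem_preimage, OpenPartialHomeomorph.symm_target, hσcs, hΦesymm]
    exact hveK z
  -- smoothness of the translated stereographic chart
  have hσsm : ContMDiffOn (𝓡 3) 𝓘(ℝ, 𝔼 3) ∞ σ {v}ᶜ := by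
    rw [hσ]; exact contMDiffOn_stereographic' v
  have hσc_sm : ∀ y : 𝕊 3, y ≠ v → ContMDiffAt (𝓡 3) 𝓘(ℝ, 𝔼 3) ∞ σc y := fun y hy ↦ by
    have h1 : ContMDiffAt (𝓡 3) 𝓘(ℝ, 𝔼 3) ∞ σ y :=
      hσsm.contMDiffAt (isOpen_compl_singleton.mem_nhds hy)
    have h2 : ContMDiff 𝓘(ℝ, 𝔼 3) 𝓘(ℝ, 𝔼 3) ∞ fun w : 𝔼 3 ↦ w + -c :=
      contMDiff_iff_contDiff.2 (contDiff_id.add contDiff_const)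
    exact h2.contMDiffAt.comp y h1
  have hσc_symm_sm : ContMDiff 𝓘(ℝ, 𝔼 3) (𝓡 3) ∞ σc.symm := by
    have : (σc.symm : 𝔼 3 → 𝕊 3) = σ.symm ∘ fun w ↦ w + c := funext hσc_symm
    rw [this]
    have h2 : ContMDiff 𝓘(ℝ, 𝔼 3) 𝓘(ℝ, 𝔼 3) ∞ fun w : 𝔼 3 ↦ w + c :=
      contMDiff_iff_contDiff.2 (contDiff_id.add contDiff_const)
    exact (hσ ▸ contMDiff_stereographic'_symm v).comp h2
  -- smoothness of `Φ⁻¹ = σ_c ∘ e ∘ K`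
  have hKsmM : ContMDiff 𝓘(ℝ, 𝔼 3) 𝓘(ℝ, 𝔼 3) ∞ K := contMDiff_iff_contDiff.2 hKsm
  have hΦ' : ContMDiff 𝓘(ℝ, 𝔼 3) 𝓘(ℝ, 𝔼 3) ∞ Φ.symm := by
    have : (Φ.symm : 𝔼 3 → 𝔼 3) = fun z ↦ σc (e (K z)) := funext hΦsymm
    rw [this]
    intro z
    exact (hσc_sm _ (hveK z)).comp z ((he.contMDiff.comp hKsmM) z)
  -- smoothness of `Φ` on its source
  have hKsymm_sm : ContMDiffOn 𝓘(ℝ, 𝔼 3) 𝓘(ℝ, 𝔼 3) ∞ K.symm K.target :=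
    contMDiffOn_iff_contDiffOn.2 hKsm'
  have hΦsm : ContMDiffOn 𝓘(ℝ, 𝔼 3) 𝓘(ℝ, 𝔼 3) ∞ Φ Φ.source := by
    intro x hx
    have hx' := hx
    rw [hΦ_def, OpenPartialHomeomorph.trans_source, OpenPartialHomeomorph.trans_source] at hx'
    obtain ⟨⟨-, hx₁⟩, hx₂⟩ := hx'
    rw [mem_preimage] at hx₁ hx₂
    rw [OpenPartialHomeomorph.coe_trans] at hx₂
    have h1 : ContMDiffAt 𝓘(ℝ, 𝔼 3) (𝓡 3) ∞ σc.symm x := hσc_symm_sm x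
    have h2 : ContMDiffAt (𝓡 3) 𝓘(ℝ, 𝔼 3) ∞ Φe (σc.symm x) :=
      hΦesm.contMDiffAt (Φe.open_source.mem_nhds hx₁)
    have h3 : ContMDiffAt 𝓘(ℝ, 𝔼 3) 𝓘(ℝ, 𝔼 3) ∞ K.symm (Φe (σc.symm x)) :=
      hKsymm_sm.contMDiffAt (K.open_target.mem_nhds hx₂)
    exact (h3.comp x (h2.comp x h1)).contMDiffWithinAt
  -- `Φ⁻¹ 0 = 0`
  have h0 : Φ.symm 0 = 0 := by
    rw [hΦsymm, hK0, hσc_apply, ← hc, add_neg_cancel]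
  -- the derivative at `0`
  have hL : ∃ L : 𝔼 3 ≃L[ℝ] 𝔼 3, HasFDerivAt Φ.symm (L : 𝔼 3 →L[ℝ] 𝔼 3) 0 := by
    have hn : (∞ : WithTop ℕ∞) ≠ 0 := by simp
    have hd : DifferentiableAt ℝ Φ.symm 0 :=
      ((contMDiff_iff_contDiff.1 hΦ').contDiffAt).differentiableAt hn
    have hmem : Φ.symm 0 ∈ Φ.source := Φ.map_target (by rw [hΦt]; trivial)
    have hd' : DifferentiableAt ℝ Φ.symm.symm (Φ.symm 0) := by
      rw [OpenPartialHomeomorph.symm_symm]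
      have h1 : ContMDiffAt 𝓘(ℝ, 𝔼 3) 𝓘(ℝ, 𝔼 3) ∞ Φ (Φ.symm 0) :=
        hΦsm.contMDiffAt (Φ.open_source.mem_nhds hmem)
      exact (contMDiffAt_iff_contDiffAt.1 h1).differentiableAt hn
    exact OpenPartialHomeomorph.exists_hasFDerivAt_equiv Φ.symm
      (by rw [OpenPartialHomeomorph.symm_source, hΦt]; trivial) hd hd'
  -- the image of the unit sphere
  have himg : e '' sphere 0 1 = (fun w ↦ σ.symm (w + c)) '' (Φ.symm '' sphere 0 a) := by
    rw [image_image, ← hKa, image_image]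
    refine image_congr fun z _ ↦ ?_
    rw [hΦsymm, hσc_apply, neg_add_cancel_right]
    exact (σ.left_inv (by rw [hσ, stereographic'_source]; exact hveK z)).symm
  exact ⟨Φ, a, c, hΦt, hΦsm, hΦ', h0, ha, hL, himg⟩

/-! ### The isotopy form of the Schoenflies theorem from the ball form -/

namespace SphereEmbedding

open KnotsInBall

/-- **The isotopy form of the Schoenflies theorem in `S³` from the ball form.** Granted
Alexander's theorem in ball form (`schoenflies_exists_ball`, threaded as `hB`: the side of a
smoothly embedded 2-sphere `S ⊆ 𝕊 3` away from a point `p ∉ S` is a smoothly embedded closed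
3-ball `e (D³)`, `e (S²) = S`), some ambient isotopy of `𝕊 3` carries `range S` onto the
standard equator `{x₃ = 0}`. This is the disc theorem of Palais–Cerf–Hirsch (Hirsch (1976),
Ch. 8 §3, Thm. 3.1: embedded discs which both preserve or both reverse orientation are
isotopic, ambiently by Thm. 8.1.3) applied to the *image* of the disc, for which the
orientation proviso is vacuous (reflect the source). *Proof.* Take `p ∉ S`
(`SphereEmbedding.exists_notMem_range`) and move it to the north pole `n` by a diffeomorphism
diffeotopic to the identity (homogeneity, `Diffeomorph.exists_isDiffeotopicToId_apply_eq_euclidean`);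
the ball `e (D³)` given by `hB` misses `n`, indeed `e (B(0, r))` misses `n` for some `r > 1`
(injectivity of `e`). In the stereographic chart `σ` from `n`, translated by `c = σ (e 0)`, the
map `f = σ_c ∘ e ∘ K` (`K` a radial diffeomorphism `ℝ³ ≅ B(0, r)`-shaped stretch with
`K (S(0, a)) = S²`) is the inverse of a smooth chart of `ℝ³` (`exists_chart_comp_embedding`),
and the chart form of the disc argument (`exists_ambientIsotopy_image_sphere_of_chart'`:
contraction along the chart, straight-line linearisation, a path in `GL⁺(3)`) yields a
compactly supported ambient isotopy of `ℝ³` carrying `f (S(0, a))` onto the round sphere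
`S(-c, 2)`; transported back along `σ_c` (`AmbientIsotopy.alongChart`) its end stage carries
`range S = e (S²) = σ_c⁻¹ (f (S(0, a)))` onto `σ⁻¹ (S(0, 2))`, which is the equator
(`stereographic'_northPole_symm_image_sphere_two`). All stages involved are diffeotopic to the
identity (`AmbientIsotopy.isDiffeotopicToId_of_boundaryless`), so their composite is the end
stage of an ambient isotopy (`Diffeomorph.IsDiffeotopicToId.isAmbientIsotopic`).
[cite: HirschDT1976, Ch. 8 §3, Thm. 3.1 with Ch. 8 §1, Thm. 1.3] -/
theorem schoenflies_exists_ambientIsotopy_image_eq_sphereEquator_of_ball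
    (hB : schoenflies_exists_ball) : schoenflies_exists_ambientIsotopy_image_eq_sphereEquator := by
  intro S
  haveI : ConnectedSpace (𝕊 3) := by
    refine isConnected_iff_connectedSpace.mp (isConnected_sphere ?_ 0 zero_le_one)
    rw [← Module.finrank_eq_rank, finrank_euclideanSpace_fin]
    norm_num
  -- a point off `S`, moved to the north pole by a diffeomorphism diffeotopic to the identity
  obtain ⟨p, hp⟩ := S.exists_notMem_range (by norm_num)
  obtain ⟨P₀, hP₀, hP₀p⟩ :=
    Diffeomorph.exists_isDiffeotopicToId_apply_eq_euclidean 3 (𝕊 3) p northPole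
  have hNP : (northPole : 𝕊 3) ∉ range (S.map P₀) := by
    rw [SphereEmbedding.range_map]
    rintro ⟨x, hx, hxe⟩
    have : x = p := P₀.injective (hxe.trans hP₀p.symm)
    exact hp (this ▸ hx)
  -- the ball bounded by `P₀ ∘ S` away from the north pole
  obtain ⟨e, he, heS, heNP⟩ := hB (S.map P₀) northPole hNP
  obtain ⟨r, hr1, hr⟩ : ∃ r : ℝ, 1 < r ∧ ∀ z : 𝔼 3, ‖z‖ < r → e z ≠ northPole := by
    by_cases h : (northPole : 𝕊 3) ∈ range e
    · obtain ⟨x₀, hx₀⟩ := h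
      have hx₀1 : 1 < ‖x₀‖ := by
        by_contra hle
        exact heNP ⟨x₀, mem_closedBall_zero_iff.2 (not_lt.1 hle), hx₀⟩
      refine ⟨‖x₀‖, hx₀1, fun z hz hze ↦ ?_⟩
      have : z = x₀ := he.isEmbedding.injective (hze.trans hx₀.symm)
      rw [this] at hz
      exact lt_irrefl _ hz
    · exact ⟨2, one_lt_two, fun z _ hze ↦ h ⟨z, hze⟩⟩
  -- the chart of `ℝ³` attached to the ball, and the isotopy in the chart
  obtain ⟨Φ, a, c, hΦt, hΦ, hΦ', h0, ha, ⟨L, hL⟩, himg⟩ := exists_chart_comp_embedding he hr1 hr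
  obtain ⟨H, hH, R, hR⟩ := exists_ambientIsotopy_image_sphere_of_chart' Φ hΦt hΦ hΦ' h0 hL ha (-c)
  -- transport along the translated stereographic chart from the north pole
  set σ := stereographic' 3 (northPole : 𝕊 3) with hσ
  set σc := σ.transHomeomorph (Homeomorph.addRight (-c)) with hσc
  have hσct : σc.target = univ := by
    rw [hσc, OpenPartialHomeomorph.transHomeomorph_target, hσ, stereographic'_target, preimage_univ]
  have hσc_symm : ∀ w, σc.symm w = σ.symm (w + c) := fun w ↦ by
    rw [hσc, OpenPartialHomeomorph.transHomeomorph_symm_apply, comp_apply,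
      Homeomorph.addRight_symm, neg_neg, Homeomorph.coe_addRight]
  have hσcsm : ContMDiffOn (𝓡 3) 𝓘(ℝ, 𝔼 3) ∞ σc σc.source := by
    rw [hσc, OpenPartialHomeomorph.transHomeomorph_source]
    have h2 : ContMDiff 𝓘(ℝ, 𝔼 3) 𝓘(ℝ, 𝔼 3) ∞ fun w : 𝔼 3 ↦ w + -c :=
      contMDiff_iff_contDiff.2 (contDiff_id.add contDiff_const)
    have h1 : ContMDiffOn (𝓡 3) 𝓘(ℝ, 𝔼 3) ∞ σ σ.source := by
      rw [hσ, stereographic'_source]; exact contMDiffOn_stereographic' _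
    exact h2.comp_contMDiffOn h1
  have hσcsm' : ContMDiff 𝓘(ℝ, 𝔼 3) (𝓡 3) ∞ σc.symm := by
    have : (σc.symm : 𝔼 3 → 𝕊 3) = σ.symm ∘ fun w ↦ w + c := funext hσc_symm
    rw [this]
    have h2 : ContMDiff 𝓘(ℝ, 𝔼 3) 𝓘(ℝ, 𝔼 3) ∞ fun w : 𝔼 3 ↦ w + c :=
      contMDiff_iff_contDiff.2 (contDiff_id.add contDiff_const)
    exact (hσ ▸ contMDiff_stereographic'_symm northPole).comp h2
  let F : AmbientIsotopy (𝓡 3) (𝕊 3) := H.alongChart (φ := σc) hσcsm hσcsm' hσct hR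
  set D := F.toDiffeomorph 1 with hD_def
  have hD : Diffeomorph.IsDiffeotopicToId D := F.isDiffeotopicToId_of_boundaryless 1
  have hDσ : ∀ w, D (σc.symm w) = σc.symm (H.toFun 1 w) := fun w ↦ by
    rw [hD_def, AmbientIsotopy.coe_toDiffeomorph]
    exact chartTransport_symm_apply hσct _ w
  -- assemble
  obtain ⟨G, hG⟩ := (hP₀.trans hD).isAmbientIsotopic
  refine ⟨G, ?_⟩
  have hG1 : G.toFun 1 = ⇑D ∘ ⇑P₀ := by rw [comp_id] at hG; rw [hG, Diffeomorph.coe_trans]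
  rw [hG1, image_comp, ← SphereEmbedding.range_map, ← heS, himg, image_image]
  have : (fun w ↦ D (σ.symm (w + c))) '' (Φ.symm '' sphere (0 : 𝔼 3) a) =
      (fun w ↦ σ.symm (H.toFun 1 w + c)) '' (Φ.symm '' sphere (0 : 𝔼 3) a) :=
    image_congr fun w _ ↦ by rw [← hσc_symm, hDσ, hσc_symm]
  rw [this, ← image_image (g := fun u ↦ σ.symm (u + c)) (f := H.toFun 1), hH,
    ← image_image (g := (σ.symm : 𝔼 3 → 𝕊 3)) (f := fun u : 𝔼 3 ↦ u + c),
    image_add_right_sphere_neg, hσ, stereographic'_northPole_symm_image_sphere_two]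

end SphereEmbedding

/-! ### Schubert's theorem from Alexander's theorem (ball form) and normal position -/

namespace Knot

/-- **Reduction of Schubert's theorem, with the Schoenflies input in ball form.** The connected
sum of oriented knots is well defined (`Knot.IsConnectedSum.isIsotopic`, `BandSum.lean`; Schubert
(1949); Cromwell (2004), §4.6), granted (i) Alexander's theorem / the Schoenflies theorem in
`S³` in ball form (`SphereEmbedding.schoenflies_exists_ball`, Schultens (2014), Thm. 3.2.5) and
(ii) Schubert's theorem for presentations in normal position with equal summands
(`Knot.Schubert1949_normalPosition`, Cromwell (2004), §4.6): the tree's reduction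
`IsConnectedSum.isIsotopic_of_normalPosition` (`ConnectedSumNormalForm.lean`) fed with the
isotopy form of the Schoenflies theorem proved above from the ball form.
[cite: Cromwell2004, §4.6 (PDF p. 69)] -/
theorem IsConnectedSum.isIsotopic_of_ball_of_normalPosition
    (hB : SphereEmbedding.schoenflies_exists_ball) (hH : Schubert1949_normalPosition) :
    IsConnectedSum.isIsotopic :=
  IsConnectedSum.isIsotopic_of_normalPosition
    (SphereEmbedding.schoenflies_exists_ambientIsotopy_image_eq_sphereEquator_of_ball hB) hH

end Knot

end Literature.Topology.FourManifolds
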